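import Summits.AtomisticToContinuum.BoseEinsteinCondensation.Theses.BECInsertionCorrector
import Summits.AtomisticToContinuum.BoseEinsteinCondensation.Theses.BECPeriodicReduction
import Summits.AtomisticToContinuum.BoseEinsteinCondensation.Theses.BECWallDressingTransfer
import Literature.MathematicalPhysics.QuantumManyBody.BoseEinsteinCondensation
import Literature.MathematicalPhysics.QuantumManyBody.PeriodicBoseGas
import Literature.MathematicalPhysics.QuantumManyBody.GroundState
import Summits.AtomisticToContinuum.BoseEinsteinCondensation.Theorems.BECInsertionCorrectorBoundaryTransferWeakMultiplicativeTransfer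
import Summits.AtomisticToContinuum.BoseEinsteinCondensation.Theorems.BECInsertionCorrectorBoundaryTransferWeakClosing
import Summits.AtomisticToContinuum.BoseEinsteinCondensation.Theorems.BECInsertionCorrectorBoundaryTransferWeakTorusTypicalityBath
import Summits.AtomisticToContinuum.BoseEinsteinCondensation.Theorems.BECInsertionCorrectorBoundaryTransferWeakBoxTransferBath
import Summits.AtomisticToContinuum.BoseEinsteinCondensation.Theorems.BECInsertionCorrectorBoundaryTransferWeakFreeDirichletGap
import Summits.AtomisticToContinuum.BoseEinsteinCondensation.Theorems.BECInsertionCorrectorBoundaryTransferWeakFreeTorusSlices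
import Summits.AtomisticToContinuum.BoseEinsteinCondensation.Theorems.BECInsertionCorrectorBoundaryTransferWeakFreeGroundState
import Summits.AtomisticToContinuum.BoseEinsteinCondensation.Theorems.BECInsertionCorrectorBoundaryTransferWeakFreeCoupledRelocation
import Summits.AtomisticToContinuum.BoseEinsteinCondensation.Theorems.BECInsertionCorrectorBoundaryTransferWeakFreeOneBodyApprox
import Mathlib.MeasureTheory.Measure.WithDensity
import Mathlib.Analysis.SpecialFunctions.Exp
import Mathlib.Analysis.SpecialFunctions.Pow.Real

/-!
# Line `Sketch` (crux idea `coupled-bath-relocation`) for crux `BoundaryTransferWeak`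
# (stmt-AtomisticToContinuum-0827) — SKELETON v3 (v2: lead prover-line-stmt-AtomisticToContinuum-0827-0; v3 reshape: continuation lead c1; run by continuation lead c2, 2026-08-17)

Crux (route decl, per potential): `BECInsertionCorrector.BoundaryTransferWeak` (= `rfl`
`BECPeriodicReduction.BoundaryTransferWeak`, the decl recorded on the item) :=
`∀ v admissible, PeriodicBECAt v → ∃ ρ₀ > 0, ∀ ρ ∈ (0, ρ₀), HasGroundStateBEC v ρ`.

The line (idea card `Cruxes/BoundaryTransferWeak/Ideas/coupled-bath-relocation.md`): couple the law
`Q = Ψ_D²` of the Dirichlet ground state `Ψ_D = groundState v (n+1) L` (box of side `L = L_{n+1}(ρ)`)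
with the law `P = |Φ|²|_cell` of a torus near-minimiser `Φ` of the SAME `n+1` particles on the cell
(= the box) so that, with probability `≥ 1 - η`, the two one-body SLICES `ψ = Ψ_D(·, X̂)`,
`φ = |Φ(·, Ŷ)|` have bounded RELATIVE relocation cost on the inner cube `C = (L/4, 3L/4)³` off a small
exceptional set `S` (`ψ(x)φ(y) ≤ e^M ψ(y)φ(x)` on `C ∖ S`) and, one-directionally, from `C` to the rest
of the cell (`ψ(y)φ(x) ≤ e^M ψ(x)φ(y)`, `x ∈ C ∖ S`, `y ∈ (cell ∖ C) ∖ T`, `T` of small `ψ`-mass).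
Torus BEC `A` gives (sub-cube pigeonhole + rigid translation + one-bath disintegration + reverse
Markov) a `P`-typical BATH event on which the torus slice has in-cube mass fraction `q_C(φ) ≥ c/16` and
Bhattacharyya flatness `BC_C(φ)² = (∫_C φ)²/(|C| ∫_C φ²) ≥ c/16`; both transfer MULTIPLICATIVELY to the
box slice under the pairwise bounds; so the inner flat mode of the box is occupied
`≥ κ(c, ε, η, M)·(n+1)` in `Ψ_D`, and the landed ground-state → near-minimiser → rigidity →
`condensateNumber` chain closes `HasGroundStateBEC v ρ`.

## v2 RESHAPE (cycle 1, lead): `stub_coupledRelocationBound` v1 was MIS-STATED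

v1 (the card's typing) put the tagged particles' agreement on `C`-membership, `(Z 0 ∈ C ↔ W 0 ∈ C)`,
inside the probability-`(1-η)` good event.  That forces `|Q{z₀ ∈ C} - P{w₀ ∈ C}| ≤ η` for every `η > 0`,
eventually — FALSE at the line's own calibration point `v = 0`: the free Dirichlet ground state is
`∏ (2/L)^{3/2} ∏_α sin(π x_{iα}/L)`, so `Q{z₀ ∈ C} = (1/2 + 1/π)³ = 0.548`, while the constant torus
state (an exact minimiser, `periodicEnergy 0 = 0`) has `P{w₀ ∈ C} = |C|/L³ = 1/8`; no coupling charges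
`{z₀ ∈ C ↔ w₀ ∈ C}` with more than `1 - 0.42`.  (For `a > 0` the Dirichlet one-body density is bulk-flat
and the defect is `O(ξ/L) → 0`, which is why the card did not notice.)  Repair: the box functional is
rewritten as a function of the BATH only — `n_C(Ψ)/N = E_Q[q_C(ψ_X̂) · BC_C(ψ_X̂)²]` with
`q_C(ψ) = ∫_C ψ² / ∫ ψ²` the in-cube mass fraction of the slice — so no tagged-particle matching is
needed; the price is the one-directional outside bound above (true at `v = 0` with `M₀ = (3/2) log 2`,
`S = T = ∅`, ANY coupling), which transfers `q_C` exactly as the two-sided bound transfers `BC_C`.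
The v1 stubs `stub_torusTypicality` (p139087) and `stub_boxTransfer` (p140439) are landed, true, and
superseded by their bath-level versions below; `stub_multiplicativeTransfer` (p139456) and
`stub_closing` (p140758) are used as they stand.

TYPING (lead's decision, see PICKED.md): torus side over `δ`-near-minimisers (`δ` after `N`, `A`'s own
objects), Dirichlet side over the tree's `groundState` (a normalised nonnegative minimiser of the closed
form whenever `E₀ < ⊤`, which holds eventually at low density:
`BECInsertionVariance.eventually_groundStateEnergy_ne_top`, `isGroundState_groundState_of_ne_top`).
The inner cube is `TorusInTheBox`'s `θ = 1/4` cube written literally, so that `measurableSet_innerCube`,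
`volume_innerCube`, `lintegral_innerFlatMode_sq`, `aestronglyMeasurable_innerFlatMode` apply.

Registered stubs (signatures in TREE VOCABULARY ONLY):
* `stub_torusTypicalityBath`   (T′; LANDED p141327) — where `A` enters; bath-level event.
* `stub_coupledRelocationBound` (R′) — v3: PROVED from `stub_freeDirichletGap` (LANDED p148396),
  `stub_freeOneBodyApprox` (LANDED p149376; helpers p148855 p149200), `stub_freeGroundState` (LANDED p149094),
  `stub_freeTorusSlices` (LANDED p148937), `stub_freeCoupledRelocation` (LANDED p149215, core p148988) — the free
  class — and `stub_coupledRelocationBound_ne_zero` (R′ for `v ≠ 0`; RESEARCH, held by the lead; dead per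
  `Lines/Sketch_dead.md` + lead c2 addendum) — the only cross-b.c. input.
* `stub_multiplicativeTransfer` (M; LANDED p139456).
* `stub_boxTransferBath`        (B′; LANDED p143900) — coupling arithmetic on the box side, `M →`.
* `stub_closing`                (C; LANDED p140758).
* `stub_rigidity`               (pooled item stmt-AtomisticToContinuum-9072 verbatim; not worked here).
The assembly `assembly` is PROVED in this file (no stub).  `BoundaryTransferWeak_proof` concludes the
crux BY NAME.
-/

noncomputable section

namespace Summit.AtomisticToContinuum.BoseEinsteinCondensation.Cruxes.BoundaryTransferWeak.CoupledBaths

open Literature.MathematicalPhysics.QuantumManyBody.BoseGas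
open _root_.MeasureTheory _root_.Filter
open scoped ENNReal NNReal
open Summit.AtomisticToContinuum.BoseEinsteinCondensation.Theses

/-! ### Vocabulary (local abbreviations; the registered stubs below are stated UNFOLDED) -/

/-- The inner cube `C = (L/4, 3L/4)³` of the box / cell of side `L` (`TorusInTheBox` form, `θ = 1/4`). -/
def innerCube (L : ℝ) : Set Space :=
  {x : Space | ∀ t, x t ∈ Set.Ioo (1 / 4 * L) (L - 1 / 4 * L)}

/-- The normalised flat mode of the inner cube (`TorusInTheBox` normalisation with `θ = 1/4`). -/
def innerMode (L : ℝ) : Space → ℂ :=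
  (innerCube L).indicator fun _ => ((Real.sqrt (((1 - 2 * (1 / 4)) * L) ^ 3))⁻¹ : ℂ)

/-- The law `Q = Ψ_D² dZ` of the Dirichlet ground state `Ψ_D = groundState v (n+1) L` on `(ℝ³)^{n+1}`. -/
def gsLaw (v : ℝ → ℝ≥0∞) (n : ℕ) (L : ℝ) : Measure (Config (n + 1)) :=
  volume.withDensity fun Z => ENNReal.ofReal (groundState v (n + 1) L Z) ^ 2

/-- The law `P = |Φ|² 1_{cell^{n+1}} dW` of a periodic trial state on the fundamental cell. -/
def torusLaw {n : ℕ} {L : ℝ} (Φ : PeriodicTrialState (n + 1) L) : Measure (Config (n + 1)) :=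
  (volume.restrict (cellN (n + 1) L)).withDensity fun W => (‖Φ.ψ W‖₊ : ℝ≥0∞) ^ 2

/-- The GOOD EVENT (v2, bath level) of a pair (box configuration `Z`, torus configuration `W`) at
tolerance `ε` and cost bound `M`, a statement about the two SLICES `ψ = Ψ_D(·, tail Z) ≥ 0` and
`φ = |Φ(·, tail W)|` only: `ψ` has positive finite mass on `C` and finite total mass; off an
exceptional measurable `S ⊆ C` of relative volume `≤ ε` carrying `≤ ε` of both in-cube slice masses
the relative relocation cost is bounded two-sidedly INSIDE `C`, `ψ(x)φ(y) ≤ e^M ψ(y)φ(x)`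
(`x, y ∈ C ∖ S`); and off a measurable `T` of `ψ`-mass `≤ ε ∫ψ²` it is bounded one-sidedly from `C`
OUTWARDS, `ψ(y)φ(x) ≤ e^M ψ(x)φ(y)` (`x ∈ C ∖ S`, `y ∈ (cell ∖ C) ∖ T`): the box slice puts
relatively no more mass outside the inner cube than the torus slice does. -/
def GoodPair (v : ℝ → ℝ≥0∞) (n : ℕ) (L : ℝ) (Φ : PeriodicTrialState (n + 1) L) (ε M : ℝ)
    (Z W : Config (n + 1)) : Prop :=
  0 < ∫⁻ x in {x : Space | ∀ t, x t ∈ Set.Ioo (1 / 4 * L) (L - 1 / 4 * L)},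
      ENNReal.ofReal (groundState v (n + 1) L (Matrix.vecCons x (Matrix.vecTail Z))) ^ 2 ∧
  ∫⁻ x in {x : Space | ∀ t, x t ∈ Set.Ioo (1 / 4 * L) (L - 1 / 4 * L)},
      ENNReal.ofReal (groundState v (n + 1) L (Matrix.vecCons x (Matrix.vecTail Z))) ^ 2 < ⊤ ∧
  ∫⁻ x, ENNReal.ofReal (groundState v (n + 1) L (Matrix.vecCons x (Matrix.vecTail Z))) ^ 2 < ⊤ ∧
  ∃ S ⊆ {x : Space | ∀ t, x t ∈ Set.Ioo (1 / 4 * L) (L - 1 / 4 * L)},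
    MeasurableSet S ∧
    volume S ≤ ENNReal.ofReal ε * volume {x : Space | ∀ t, x t ∈ Set.Ioo (1 / 4 * L) (L - 1 / 4 * L)} ∧
    ∫⁻ x in S, ENNReal.ofReal (groundState v (n + 1) L (Matrix.vecCons x (Matrix.vecTail Z))) ^ 2 ≤
      ENNReal.ofReal ε * ∫⁻ x in {x : Space | ∀ t, x t ∈ Set.Ioo (1 / 4 * L) (L - 1 / 4 * L)},
        ENNReal.ofReal (groundState v (n + 1) L (Matrix.vecCons x (Matrix.vecTail Z))) ^ 2 ∧
    ∫⁻ y in S, ENNReal.ofReal ‖Φ.ψ (Matrix.vecCons y (Matrix.vecTail W))‖ ^ 2 ≤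
      ENNReal.ofReal ε * ∫⁻ y in {x : Space | ∀ t, x t ∈ Set.Ioo (1 / 4 * L) (L - 1 / 4 * L)},
        ENNReal.ofReal ‖Φ.ψ (Matrix.vecCons y (Matrix.vecTail W))‖ ^ 2 ∧
    (∀ x ∈ {x : Space | ∀ t, x t ∈ Set.Ioo (1 / 4 * L) (L - 1 / 4 * L)} \ S,
      ∀ y ∈ {x : Space | ∀ t, x t ∈ Set.Ioo (1 / 4 * L) (L - 1 / 4 * L)} \ S,
        groundState v (n + 1) L (Matrix.vecCons x (Matrix.vecTail Z)) * ‖Φ.ψ (Matrix.vecCons y (Matrix.vecTail W))‖ ≤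
          Real.exp M * (groundState v (n + 1) L (Matrix.vecCons y (Matrix.vecTail Z)) * ‖Φ.ψ (Matrix.vecCons x (Matrix.vecTail W))‖)) ∧
    ∃ T : Set Space, MeasurableSet T ∧
      ∫⁻ y in T, ENNReal.ofReal (groundState v (n + 1) L (Matrix.vecCons y (Matrix.vecTail Z))) ^ 2 ≤
        ENNReal.ofReal ε * ∫⁻ x, ENNReal.ofReal (groundState v (n + 1) L (Matrix.vecCons x (Matrix.vecTail Z))) ^ 2 ∧
      ∀ x ∈ {x : Space | ∀ t, x t ∈ Set.Ioo (1 / 4 * L) (L - 1 / 4 * L)} \ S,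
        ∀ y ∈ (cell L \ {x : Space | ∀ t, x t ∈ Set.Ioo (1 / 4 * L) (L - 1 / 4 * L)}) \ T,
          groundState v (n + 1) L (Matrix.vecCons y (Matrix.vecTail Z)) * ‖Φ.ψ (Matrix.vecCons x (Matrix.vecTail W))‖ ≤
            Real.exp M * (groundState v (n + 1) L (Matrix.vecCons x (Matrix.vecTail Z)) * ‖Φ.ψ (Matrix.vecCons y (Matrix.vecTail W))‖)

/-- The TORUS-TYPICAL BATH EVENT at level `c` (v2): the slice `φ = |Φ(·, tail W)|` has positive mass on
`C`, finite mass on the cell, in-cube mass fraction `q_C(φ) = ∫_C φ² / ∫_cell φ² ≥ c/16` and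
Bhattacharyya flatness `(∫_C φ)² ≥ (c/16) |C| ∫_C φ²`.  (Depends on `W` only through `tail W`.) -/
def TorusGood {n : ℕ} {L : ℝ} (Φ : PeriodicTrialState (n + 1) L) (c : ℝ) (W : Config (n + 1)) :
    Prop :=
  0 < ∫⁻ y in {x : Space | ∀ t, x t ∈ Set.Ioo (1 / 4 * L) (L - 1 / 4 * L)},
      ENNReal.ofReal ‖Φ.ψ (Matrix.vecCons y (Matrix.vecTail W))‖ ^ 2 ∧
  ∫⁻ y in cell L, ENNReal.ofReal ‖Φ.ψ (Matrix.vecCons y (Matrix.vecTail W))‖ ^ 2 < ⊤ ∧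
  ENNReal.ofReal (c / 16) * ∫⁻ y in cell L, ENNReal.ofReal ‖Φ.ψ (Matrix.vecCons y (Matrix.vecTail W))‖ ^ 2 ≤
    ∫⁻ y in {x : Space | ∀ t, x t ∈ Set.Ioo (1 / 4 * L) (L - 1 / 4 * L)},
      ENNReal.ofReal ‖Φ.ψ (Matrix.vecCons y (Matrix.vecTail W))‖ ^ 2 ∧
  ENNReal.ofReal (c / 16) *
      (volume {x : Space | ∀ t, x t ∈ Set.Ioo (1 / 4 * L) (L - 1 / 4 * L)} *
        ∫⁻ y in {x : Space | ∀ t, x t ∈ Set.Ioo (1 / 4 * L) (L - 1 / 4 * L)},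
          ENNReal.ofReal ‖Φ.ψ (Matrix.vecCons y (Matrix.vecTail W))‖ ^ 2) ≤
    (∫⁻ y in {x : Space | ∀ t, x t ∈ Set.Ioo (1 / 4 * L) (L - 1 / 4 * L)},
        ENNReal.ofReal ‖Φ.ψ (Matrix.vecCons y (Matrix.vecTail W))‖) ^ 2

/-- The box constant (v2) `κ(c, ε, η, M) = (c/16 - η) · κ₀ · κ₁ / 2` with
`κ₀ = e^{-2M}(1-ε)(√c/4-ε)²` (flatness transfer) and `κ₁ = (1-ε)/(1 + 16e^{2M}/(c(1-ε)))`
(in-cube mass-fraction transfer). -/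
def boxConstant (c ε η M : ℝ) : ℝ :=
  (c / 16 - η) * ((Real.exp (-2 * M) * ((1 - ε) * (Real.sqrt c / 4 - ε) ^ 2)) *
          ((1 - ε) / (1 + 16 * Real.exp (2 * M) / (c * (1 - ε))))) / 2

/-! ### Named statements of the line -/

/-- **T′ — torus typicality, bath level** (provable now): an `A`-instance with constant `c` at slack
`δ` on the torus of side `L` yields a `δ`-near-minimiser `Φ` whose law charges the torus-typical BATH
event at level `c` with probability `≥ c/16`.  (Near-minimiser existence; sub-cube pigeonhole
`n₀ ≤ Σ_j n_{C_j}`; rigid translation `PeriodicTrialState.exists_translate`/`periodicEnergy_translate`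
onto the inner cube; one-bath disintegration `n_C(Φ)/N ≤ E_P[q_C(φ_Ŵ)·BC_C(φ_Ŵ)²]` with
`q_C · BC_C² = (∫_C φ)²/(|C| ∫_cell φ²) ≤ 1`; reverse Markov; on `{F ≥ c/16}` both factors are
`≥ c/16`.)  The v1 form with the tagged particle, `stub_torusTypicality`, is landed (p139087). -/
def TorusTypicality : Prop :=
  ∀ (v : ℝ → ℝ≥0∞) (n : ℕ) (L : ℝ), 0 < L → ∀ c : ℝ, 0 < c → ∀ δ : ℝ≥0∞, 0 < δ →
    (∀ Φ : PeriodicTrialState (n + 1) L,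
      periodicEnergy v Φ ≤ periodicGroundStateEnergy v (n + 1) L + δ →
        ENNReal.ofReal (c * (n + 1 : ℕ)) ≤ condensateOccupation (n + 1) L Φ.ψ) →
    ∃ Φ : PeriodicTrialState (n + 1) L,
      periodicEnergy v Φ ≤ periodicGroundStateEnergy v (n + 1) L + δ ∧
      ∃ E : Set (Config (n + 1)), MeasurableSet E ∧
        ENNReal.ofReal (c / 16) ≤ torusLaw Φ E ∧ ∀ W ∈ E, TorusGood Φ c W

/-- **R′ — coupled relocation bound** (RESEARCH STUB of the line, v2, typed over the tree's objects):
for every admissible `v`, at small density, for all tolerances `ε, η > 0` there is a cost bound `M`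
such that eventually in `N = n+1` (whenever `E₀^D < ⊤`), at some slack `δ > 0`, for every torus
`δ`-near-minimiser `Φ` the laws `Q = (groundState v (n+1) L)²` and `P = |Φ|²|_cell` admit a coupling
charging a measurable good event (`GoodPair … ε M`, bath level) with probability `≥ 1 - η`.  No printed
source (Dobrushin–Shlosman-type bounded boundary influence for the ground-state law); calibration
`v = 0`: true with `M₀ = (3/2) log 2 + log 3`, any coupling, for `δ` small after `(n, ε, η)`. -/
def CoupledRelocationBound : Prop :=
  ∀ v : ℝ → ℝ≥0∞, IsRepulsiveFiniteRange v → ∃ ρ₁ : ℝ, 0 < ρ₁ ∧ ∀ ρ : ℝ, 0 < ρ → ρ < ρ₁ →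
    ∀ ε : ℝ, 0 < ε → ∀ η : ℝ, 0 < η → ∃ M : ℝ, ∀ᶠ n : ℕ in atTop,
      groundStateEnergy v (n + 1) (sideLength ρ (n + 1)) ≠ ⊤ →
      ∃ δ : ℝ≥0∞, 0 < δ ∧ ∀ Φ : PeriodicTrialState (n + 1) (sideLength ρ (n + 1)),
        periodicEnergy v Φ ≤ periodicGroundStateEnergy v (n + 1) (sideLength ρ (n + 1)) + δ →
        ∃ π : Measure (Config (n + 1) × Config (n + 1)),
          π.map Prod.fst = gsLaw v n (sideLength ρ (n + 1)) ∧ π.map Prod.snd = torusLaw Φ ∧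
          ∃ G : Set (Config (n + 1) × Config (n + 1)), MeasurableSet G ∧
            ENNReal.ofReal (1 - η) ≤ π G ∧
            ∀ p ∈ G, GoodPair v n (sideLength ρ (n + 1)) Φ ε M p.1 p.2

/-- **M — multiplicative Bhattacharyya flatness transfer** (card's `MultiplicativeFlatnessTransfer`;
LANDED p139456). -/
def MultiplicativeFlatnessTransfer : Prop :=
  ∀ (C : Set Space) (f g : Space → ℝ) (M : ℝ), MeasurableSet C → Measurable f → Measurable g →
    (∀ x ∈ C, 0 ≤ f x) → (∀ x ∈ C, 0 ≤ g x) →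
    (∀ x ∈ C, ∀ y ∈ C, f x * g y ≤ Real.exp M * (f y * g x)) →
      (∫⁻ x in C, ENNReal.ofReal (g x)) ^ 2 * ∫⁻ x in C, ENNReal.ofReal (f x) ^ 2 ≤
        ENNReal.ofReal (Real.exp (2 * M)) *
          ((∫⁻ x in C, ENNReal.ofReal (f x)) ^ 2 * ∫⁻ x in C, ENNReal.ofReal (g x) ^ 2)

/-- **B′ — box transfer, bath level** (provable now): the coupling arithmetic.  From `M`, a coupling
with a good event of probability `≥ 1 - η` and a torus-typical bath event of probability `≥ c/16`,
the inner flat mode of the box is occupied `≥ κ(c,ε,η,M)·(n+1)` in the Dirichlet ground state: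
`n_C(Ψ_D)/N = E_Q[f]`, `f(Z) = (∫_C ψ)²/(|C| ∫ ψ²) = q_C(ψ)·BC_C(ψ)²`, and on `G ∩ snd⁻¹E`
`BC_C(ψ)² ≥ κ₀` (two-sided bound + `M`) and `q_C(ψ) ≥ κ₁` (outside bound), so
`E_Q[f] ≥ κ₀κ₁ · π(G ∩ snd⁻¹E) ≥ κ₀κ₁(c/16 - η)`. -/
def BoxTransfer : Prop :=
  MultiplicativeFlatnessTransfer →
  ∀ (v : ℝ → ℝ≥0∞) (n : ℕ) (L : ℝ), 0 < L → groundStateEnergy v (n + 1) L ≠ ⊤ →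
    ∀ (c ε η M : ℝ), 0 < c → 0 < ε → ε ≤ Real.sqrt c / 8 → ε ≤ 1 / 2 → 0 < η → η < c / 16 →
    ∀ Φ : PeriodicTrialState (n + 1) L,
      (∃ π : Measure (Config (n + 1) × Config (n + 1)),
        π.map Prod.fst = gsLaw v n L ∧ π.map Prod.snd = torusLaw Φ ∧
        ∃ G : Set (Config (n + 1) × Config (n + 1)), MeasurableSet G ∧
          ENNReal.ofReal (1 - η) ≤ π G ∧ ∀ p ∈ G, GoodPair v n L Φ ε M p.1 p.2) →
      (∃ E : Set (Config (n + 1)), MeasurableSet E ∧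
        ENNReal.ofReal (c / 16) ≤ torusLaw Φ E ∧ ∀ W ∈ E, TorusGood Φ c W) →
      ENNReal.ofReal (boxConstant c ε η M * (n + 1 : ℕ)) ≤
        occupation (n + 1) (innerMode L) fun Z => (groundState v (n + 1) L Z : ℂ)

/-- **C — closing chain, per potential** (LANDED p140758): inner flat-mode occupation `≥ κ(n+1)` of
the Dirichlet ground state eventually in `n`, plus `L²`-rigidity of Dirichlet near-minimisers
(stmt-9072), give `HasGroundStateBEC v ρ`. -/
def ClosingChain : Prop :=
  ∀ v : ℝ → ℝ≥0∞, IsRepulsiveFiniteRange v → BECWallDressingTransfer.GroundStateRigidity →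
    ∃ ρ₂ : ℝ, 0 < ρ₂ ∧ ∀ ρ : ℝ, 0 < ρ → ρ < ρ₂ → ∀ κ : ℝ, 0 < κ →
      (∀ᶠ n : ℕ in atTop,
        groundStateEnergy v (n + 1) (sideLength ρ (n + 1)) ≠ ⊤ ∧
        ENNReal.ofReal (κ * (n + 1 : ℕ)) ≤
          occupation (n + 1) (innerMode (sideLength ρ (n + 1)))
            fun Z => (groundState v (n + 1) (sideLength ρ (n + 1)) Z : ℂ)) →
      HasGroundStateBEC v ρ

/-! ### Registered stubs (signatures unfolded into tree vocabulary) -/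

/-- **Stub T′** (LANDED p141327, `CoupledBaths.stub_torusTypicalityBath`): torus typicality, bath level. -/
theorem stub_torusTypicalityBath :
    ∀ (v : ℝ → ℝ≥0∞) (n : ℕ) (L : ℝ), 0 < L → ∀ c : ℝ, 0 < c → ∀ δ : ℝ≥0∞, 0 < δ →
    (∀ Φ : PeriodicTrialState (n + 1) L,
      periodicEnergy v Φ ≤ periodicGroundStateEnergy v (n + 1) L + δ →
        ENNReal.ofReal (c * (n + 1 : ℕ)) ≤ condensateOccupation (n + 1) L Φ.ψ) →
    ∃ Φ : PeriodicTrialState (n + 1) L,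
      periodicEnergy v Φ ≤ periodicGroundStateEnergy v (n + 1) L + δ ∧
      ∃ E : Set (Config (n + 1)), MeasurableSet E ∧
        ENNReal.ofReal (c / 16) ≤
          ((volume.restrict (cellN (n + 1) L)).withDensity fun W => (‖Φ.ψ W‖₊ : ℝ≥0∞) ^ 2) E ∧
        ∀ W ∈ E,
          0 < ∫⁻ y in {x : Space | ∀ t, x t ∈ Set.Ioo (1 / 4 * L) (L - 1 / 4 * L)},
              ENNReal.ofReal ‖Φ.ψ (Matrix.vecCons y (Matrix.vecTail W))‖ ^ 2 ∧
          ∫⁻ y in cell L, ENNReal.ofReal ‖Φ.ψ (Matrix.vecCons y (Matrix.vecTail W))‖ ^ 2 < ⊤ ∧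
          ENNReal.ofReal (c / 16) * ∫⁻ y in cell L, ENNReal.ofReal ‖Φ.ψ (Matrix.vecCons y (Matrix.vecTail W))‖ ^ 2 ≤
            ∫⁻ y in {x : Space | ∀ t, x t ∈ Set.Ioo (1 / 4 * L) (L - 1 / 4 * L)},
              ENNReal.ofReal ‖Φ.ψ (Matrix.vecCons y (Matrix.vecTail W))‖ ^ 2 ∧
          ENNReal.ofReal (c / 16) *
              (volume {x : Space | ∀ t, x t ∈ Set.Ioo (1 / 4 * L) (L - 1 / 4 * L)} *
                ∫⁻ y in {x : Space | ∀ t, x t ∈ Set.Ioo (1 / 4 * L) (L - 1 / 4 * L)},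
                  ENNReal.ofReal ‖Φ.ψ (Matrix.vecCons y (Matrix.vecTail W))‖ ^ 2) ≤
            (∫⁻ y in {x : Space | ∀ t, x t ∈ Set.Ioo (1 / 4 * L) (L - 1 / 4 * L)},
                ENNReal.ofReal ‖Φ.ψ (Matrix.vecCons y (Matrix.vecTail W))‖) ^ 2 :=
  _root_.Summit.AtomisticToContinuum.BoseEinsteinCondensation.CoupledBaths.stub_torusTypicalityBath

/-! #### v3 RESHAPE (continuation lead c1): the research stub R′ split by potential class

`CoupledRelocationBound` (R′ v2, registered 2026-08-17T03:58Z) is now OBTAINED from five registered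
stubs by a case split on `v = 0` (`coupledRelocationBound_of_stubs`, proved below):
* the FREE CLASS `v = 0` — the line's calibration point (v1 of R′ was false exactly here) — from four
  provable stubs: `stub_freeDirichletGap` (S1, sharp free Dirichlet bound `E ≥ 3Nπ²/L²`),
  `stub_freeOneBodyApprox` (S2a, `C¹` Dirichlet approximants of the sine mode), `stub_freeGroundState`
  (S2b, `groundState 0 N L = ∏ᵢ∏ₖ √(2/L) sin(π xᵢₖ/L)` a.e., from S1 + S2a + uniqueness for bounded `v`),
  `stub_freeTorusSlices` (S3, free torus near-minimisers have near-constant slices for all but `η` of the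
  baths, by the cell Poincaré inequality), assembled by `stub_freeCoupledRelocation` (S4, product
  coupling, `M₀ = (3/2) log 2 + log 3`, `S = T =` the slice's Chebyshev set);
* the INTERACTING CLASS `v ≠ 0`: `stub_coupledRelocationBound_ne_zero` — THE research stub (no printed
  source; bulk local indistinguishability of the Dirichlet and torus ground-state laws), held by the lead.
Honest box: the free branch of the CRUX is independently known (`boseEinsteinCondensation_at_zero`); the
free stubs certify the line's TYPING (GoodPair v2 is satisfiable at `v = 0`), not a new case of the crux. -/

/-- **Stub S1 — sharp free Dirichlet bound** (LANDED p148396, `CoupledBaths.stub_freeDirichletGap`): for every `C¹` Dirichlet state of `N` bosons in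
`Λ_L`, `⟨Ψ, -ΔΨ⟩ ≥ 3N(π/L)²` (1D sharp Dirichlet Poincaré on `(0,L)` by the Riccati multiplier
`-(π/L)cot`, i.e. `Poincare.sq_mul_integral_norm_sq_le` with `t₀` the midpoint, along each of the `3N`
coordinate lines + Tonelli; or one particle + Bose symmetry `lintegral_kineticDensity_eq_mul`). -/
theorem stub_freeDirichletGap :
    ∀ (N : ℕ) (L : ℝ), 0 < L → ∀ Ψ : TrialState N L,
      ENNReal.ofReal (3 * N * (Real.pi / L) ^ 2) ≤ energy 0 Ψ :=
  -- LANDED p148396 (wave 1, lead c2)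
  _root_.Summit.AtomisticToContinuum.BoseEinsteinCondensation.CoupledBaths.stub_freeDirichletGap

/-- **Stub S2a — free one-body approximants** (LANDED p149376, `CoupledBaths.stub_freeOneBodyApprox`; helpers p148855 p149200): for every `ε > 0` a one-particle `C¹` Dirichlet
state of `Λ_L` with free energy `≤ 3(π/L)² + ε` and `L²`-distance² `≤ ε` from the normalised sine mode
`u_L(x) = ∏ₖ √(2/L) sin(π xₖ/L)` (e.g. `∏ₖ sin(π xₖ/L)·h(xₖ/τ)·h((L-xₖ)/τ)` with `h = Real.smoothTransition`,
normalised; energies by dominated convergence as `τ → 0`). -/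
theorem stub_freeOneBodyApprox :
    ∀ (L : ℝ), 0 < L → ∀ ε : ℝ, 0 < ε → ∃ φ : TrialState 1 L,
      energy 0 φ ≤ ENNReal.ofReal (3 * (Real.pi / L) ^ 2 + ε) ∧
      ∫⁻ Y : Config 1, (‖φ.ψ Y -
          ((Set.indicator (box L)
              (fun x : Space => ∏ k : Fin 3, Real.sqrt (2 / L) * Real.sin (Real.pi * x k / L)) (Y 0) : ℝ) : ℂ)‖₊ : ℝ≥0∞) ^ 2 ≤
        ENNReal.ofReal ε :=
  -- LANDED p149376 (wave 1, lead c2; helpers p148855 p149200)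
  _root_.Summit.AtomisticToContinuum.BoseEinsteinCondensation.CoupledBaths.stub_freeOneBodyApprox

/-- **Stub S2b — the free Dirichlet ground state is the sine product** (LANDED p149094, `CoupledBaths.stub_freeGroundState`): from S1 (so that
`E₀(0,N,L) ≥ 3Nπ²/L²`) and S2a (powers of the approximants are trial states `→ u_L^{⊗N}` in `L²` with
energies `→ 3Nπ²/L²`, `powFun`/`rawEnergy_zero_powFun`), `IsGroundState 0 L u_L^{⊗N}`
(`IsGroundState.of_tendstoL2`); uniqueness for bounded potentials (`hasUniqueGroundState_of_bounded`,
`v = 0`) and nonnegativity pin the phase: `groundState 0 N L = u_L^{⊗N}` a.e. -/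
theorem stub_freeGroundState :
    (∀ (N : ℕ) (L : ℝ), 0 < L → ∀ Ψ : TrialState N L,
      ENNReal.ofReal (3 * N * (Real.pi / L) ^ 2) ≤ energy 0 Ψ) →
    (∀ (L : ℝ), 0 < L → ∀ ε : ℝ, 0 < ε → ∃ φ : TrialState 1 L,
      energy 0 φ ≤ ENNReal.ofReal (3 * (Real.pi / L) ^ 2 + ε) ∧
      ∫⁻ Y : Config 1, (‖φ.ψ Y -
          ((Set.indicator (box L)
              (fun x : Space => ∏ k : Fin 3, Real.sqrt (2 / L) * Real.sin (Real.pi * x k / L)) (Y 0) : ℝ) : ℂ)‖₊ : ℝ≥0∞) ^ 2 ≤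
        ENNReal.ofReal ε) →
    ∀ (N : ℕ) (L : ℝ), 1 ≤ N → 0 < L →
      groundState 0 N L =ᵐ[volume] fun X => ∏ i : Fin N,
        Set.indicator (box L) (fun x : Space => ∏ k : Fin 3, Real.sqrt (2 / L) * Real.sin (Real.pi * x k / L)) (X i) :=
  -- LANDED p149094 (wave 1, lead c2)
  _root_.Summit.AtomisticToContinuum.BoseEinsteinCondensation.CoupledBaths.stub_freeGroundState

/-- **Stub S3 — free torus slice typicality** (LANDED p148937, `CoupledBaths.stub_freeTorusSlices`): for a periodic `C¹` state `Φ` of `n+1` bosons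
with free energy `∫_cell |∇Φ|² ≤ δ` (`δ` after `n, L, ε, η`), all but `η` (in `|Φ|²`-probability) of the
configurations `W` have a first-particle slice `y ↦ Φ(y, tail W)` lying in a band `[μ/2, 3μ/2]` off a
measurable `B` of volume `≤ εL³` and slice mass `≤ εμ²L³` (Markov in the bath for
`∫_cell |∇_y Φ(·,Ŵ)|² ≤ t ∫_cell |Φ(·,Ŵ)|²`; cell Poincaré `local_poincare_cellShift` for `Φ(·,Ŵ) - mean`;
Chebyshev). -/
theorem stub_freeTorusSlices :
    ∀ (n : ℕ) (L : ℝ), 0 < L → ∀ ε : ℝ, 0 < ε → ∀ η : ℝ, 0 < η →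
      ∃ δ : ℝ≥0∞, 0 < δ ∧ ∀ Φ : PeriodicTrialState (n + 1) L, periodicEnergy 0 Φ ≤ δ →
        ∃ E : Set (Config (n + 1)), MeasurableSet E ∧
          ((volume.restrict (cellN (n + 1) L)).withDensity (fun W => (‖Φ.ψ W‖₊ : ℝ≥0∞) ^ 2)) Eᶜ ≤
            ENNReal.ofReal η ∧
          ∀ W ∈ E, ∃ μ : ℝ, 0 < μ ∧ ∃ B : Set Space, MeasurableSet B ∧
            volume B ≤ ENNReal.ofReal (ε * L ^ 3) ∧
            ∫⁻ y in B, ENNReal.ofReal ‖Φ.ψ (Matrix.vecCons y (Matrix.vecTail W))‖ ^ 2 ≤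
              ENNReal.ofReal (ε * μ ^ 2 * L ^ 3) ∧
            ∀ y ∈ cell L \ B, μ / 2 ≤ ‖Φ.ψ (Matrix.vecCons y (Matrix.vecTail W))‖ ∧
              ‖Φ.ψ (Matrix.vecCons y (Matrix.vecTail W))‖ ≤ 3 * μ / 2 :=
  -- LANDED p148937 (wave 1, lead c2)
  _root_.Summit.AtomisticToContinuum.BoseEinsteinCondensation.CoupledBaths.stub_freeTorusSlices

/-- **Stub S4 — free coupled relocation** (LANDED p149215, `CoupledBaths.stub_freeCoupledRelocation`; core p148988): the `v = 0` instance of R′ from S2b's conclusion and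
S3: `ρ₁ = 1`, `M₀ = (3/2) log 2 + log 3`, every `n`, `δ` from S3 at `(ε/64, η)` (note
`periodicGroundStateEnergy 0 = 0`), the PRODUCT coupling `π = Q ⊗ P`, good event
`G = {Z ∈ Λ^{n+1}, slice of Z regular} ×ˢ E`, `S = C ∩ B`, `T = B` (plus null sets): on `C` the sine slice
has ratio `≤ 2^{3/2}` (`CoupledBaths.prod_sin_le_exp_mul_prod_sin`, p144870) and the torus slice ratio `≤ 3`. -/
theorem stub_freeCoupledRelocation :
    (∀ (N : ℕ) (L : ℝ), 1 ≤ N → 0 < L →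
      groundState 0 N L =ᵐ[volume] fun X => ∏ i : Fin N,
        Set.indicator (box L) (fun x : Space => ∏ k : Fin 3, Real.sqrt (2 / L) * Real.sin (Real.pi * x k / L)) (X i)) →
    (∀ (n : ℕ) (L : ℝ), 0 < L → ∀ ε : ℝ, 0 < ε → ∀ η : ℝ, 0 < η →
      ∃ δ : ℝ≥0∞, 0 < δ ∧ ∀ Φ : PeriodicTrialState (n + 1) L, periodicEnergy 0 Φ ≤ δ →
        ∃ E : Set (Config (n + 1)), MeasurableSet E ∧
          ((volume.restrict (cellN (n + 1) L)).withDensity (fun W => (‖Φ.ψ W‖₊ : ℝ≥0∞) ^ 2)) Eᶜ ≤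
            ENNReal.ofReal η ∧
          ∀ W ∈ E, ∃ μ : ℝ, 0 < μ ∧ ∃ B : Set Space, MeasurableSet B ∧
            volume B ≤ ENNReal.ofReal (ε * L ^ 3) ∧
            ∫⁻ y in B, ENNReal.ofReal ‖Φ.ψ (Matrix.vecCons y (Matrix.vecTail W))‖ ^ 2 ≤
              ENNReal.ofReal (ε * μ ^ 2 * L ^ 3) ∧
            ∀ y ∈ cell L \ B, μ / 2 ≤ ‖Φ.ψ (Matrix.vecCons y (Matrix.vecTail W))‖ ∧
              ‖Φ.ψ (Matrix.vecCons y (Matrix.vecTail W))‖ ≤ 3 * μ / 2) →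
    ∃ ρ₁ : ℝ, 0 < ρ₁ ∧ ∀ ρ : ℝ, 0 < ρ → ρ < ρ₁ →
    ∀ ε : ℝ, 0 < ε → ∀ η : ℝ, 0 < η → ∃ M : ℝ, ∀ᶠ n : ℕ in atTop,
      groundStateEnergy 0 (n + 1) (sideLength ρ (n + 1)) ≠ ⊤ →
      ∃ δ : ℝ≥0∞, 0 < δ ∧ ∀ Φ : PeriodicTrialState (n + 1) (sideLength ρ (n + 1)),
        periodicEnergy 0 Φ ≤ periodicGroundStateEnergy 0 (n + 1) (sideLength ρ (n + 1)) + δ →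
        ∃ π : Measure (Config (n + 1) × Config (n + 1)),
          π.map Prod.fst = volume.withDensity (fun Z => ENNReal.ofReal (groundState 0 (n + 1) (sideLength ρ (n + 1)) Z) ^ 2) ∧
          π.map Prod.snd = ((volume.restrict (cellN (n + 1) (sideLength ρ (n + 1)))).withDensity fun W => (‖Φ.ψ W‖₊ : ℝ≥0∞) ^ 2) ∧
          ∃ G : Set (Config (n + 1) × Config (n + 1)), MeasurableSet G ∧
            ENNReal.ofReal (1 - η) ≤ π G ∧
            ∀ p ∈ G,
              0 < ∫⁻ x in {x : Space | ∀ t, x t ∈ Set.Ioo (1 / 4 * sideLength ρ (n + 1)) (sideLength ρ (n + 1) - 1 / 4 * sideLength ρ (n + 1))},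
                  ENNReal.ofReal (groundState 0 (n + 1) (sideLength ρ (n + 1)) (Matrix.vecCons x (Matrix.vecTail p.1))) ^ 2 ∧
              ∫⁻ x in {x : Space | ∀ t, x t ∈ Set.Ioo (1 / 4 * sideLength ρ (n + 1)) (sideLength ρ (n + 1) - 1 / 4 * sideLength ρ (n + 1))},
                  ENNReal.ofReal (groundState 0 (n + 1) (sideLength ρ (n + 1)) (Matrix.vecCons x (Matrix.vecTail p.1))) ^ 2 < ⊤ ∧
              ∫⁻ x, ENNReal.ofReal (groundState 0 (n + 1) (sideLength ρ (n + 1)) (Matrix.vecCons x (Matrix.vecTail p.1))) ^ 2 < ⊤ ∧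
              ∃ S ⊆ {x : Space | ∀ t, x t ∈ Set.Ioo (1 / 4 * sideLength ρ (n + 1)) (sideLength ρ (n + 1) - 1 / 4 * sideLength ρ (n + 1))},
                MeasurableSet S ∧
                volume S ≤ ENNReal.ofReal ε * volume {x : Space | ∀ t, x t ∈ Set.Ioo (1 / 4 * sideLength ρ (n + 1)) (sideLength ρ (n + 1) - 1 / 4 * sideLength ρ (n + 1))} ∧
                ∫⁻ x in S, ENNReal.ofReal (groundState 0 (n + 1) (sideLength ρ (n + 1)) (Matrix.vecCons x (Matrix.vecTail p.1))) ^ 2 ≤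
                  ENNReal.ofReal ε * ∫⁻ x in {x : Space | ∀ t, x t ∈ Set.Ioo (1 / 4 * sideLength ρ (n + 1)) (sideLength ρ (n + 1) - 1 / 4 * sideLength ρ (n + 1))},
                    ENNReal.ofReal (groundState 0 (n + 1) (sideLength ρ (n + 1)) (Matrix.vecCons x (Matrix.vecTail p.1))) ^ 2 ∧
                ∫⁻ y in S, ENNReal.ofReal ‖Φ.ψ (Matrix.vecCons y (Matrix.vecTail p.2))‖ ^ 2 ≤
                  ENNReal.ofReal ε * ∫⁻ y in {x : Space | ∀ t, x t ∈ Set.Ioo (1 / 4 * sideLength ρ (n + 1)) (sideLength ρ (n + 1) - 1 / 4 * sideLength ρ (n + 1))},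
                    ENNReal.ofReal ‖Φ.ψ (Matrix.vecCons y (Matrix.vecTail p.2))‖ ^ 2 ∧
                (∀ x ∈ {x : Space | ∀ t, x t ∈ Set.Ioo (1 / 4 * sideLength ρ (n + 1)) (sideLength ρ (n + 1) - 1 / 4 * sideLength ρ (n + 1))} \ S,
                  ∀ y ∈ {x : Space | ∀ t, x t ∈ Set.Ioo (1 / 4 * sideLength ρ (n + 1)) (sideLength ρ (n + 1) - 1 / 4 * sideLength ρ (n + 1))} \ S,
                    groundState 0 (n + 1) (sideLength ρ (n + 1)) (Matrix.vecCons x (Matrix.vecTail p.1)) * ‖Φ.ψ (Matrix.vecCons y (Matrix.vecTail p.2))‖ ≤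
                      Real.exp M * (groundState 0 (n + 1) (sideLength ρ (n + 1)) (Matrix.vecCons y (Matrix.vecTail p.1)) * ‖Φ.ψ (Matrix.vecCons x (Matrix.vecTail p.2))‖)) ∧
                ∃ T : Set Space, MeasurableSet T ∧
                  ∫⁻ y in T, ENNReal.ofReal (groundState 0 (n + 1) (sideLength ρ (n + 1)) (Matrix.vecCons y (Matrix.vecTail p.1))) ^ 2 ≤
                    ENNReal.ofReal ε * ∫⁻ x, ENNReal.ofReal (groundState 0 (n + 1) (sideLength ρ (n + 1)) (Matrix.vecCons x (Matrix.vecTail p.1))) ^ 2 ∧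
                  ∀ x ∈ {x : Space | ∀ t, x t ∈ Set.Ioo (1 / 4 * sideLength ρ (n + 1)) (sideLength ρ (n + 1) - 1 / 4 * sideLength ρ (n + 1))} \ S,
                    ∀ y ∈ (cell (sideLength ρ (n + 1)) \ {x : Space | ∀ t, x t ∈ Set.Ioo (1 / 4 * sideLength ρ (n + 1)) (sideLength ρ (n + 1) - 1 / 4 * sideLength ρ (n + 1))}) \ T,
                      groundState 0 (n + 1) (sideLength ρ (n + 1)) (Matrix.vecCons y (Matrix.vecTail p.1)) * ‖Φ.ψ (Matrix.vecCons x (Matrix.vecTail p.2))‖ ≤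
                        Real.exp M * (groundState 0 (n + 1) (sideLength ρ (n + 1)) (Matrix.vecCons x (Matrix.vecTail p.1)) * ‖Φ.ψ (Matrix.vecCons y (Matrix.vecTail p.2))‖) :=
  -- LANDED p149215 (lead c2; core helpers p148988)
  _root_.Summit.AtomisticToContinuum.BoseEinsteinCondensation.CoupledBaths.stub_freeCoupledRelocation

/-- **Stub R′(v ≠ 0) — coupled relocation bound, interacting class** (RESEARCH, held by the lead): R′ v2
verbatim for `v ≠ 0`. No printed source; for hard cores and `ε` below the in-cube core volume fraction it
forces near-exact positional matching of the two bulk point processes under the coupling. -/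
theorem stub_coupledRelocationBound_ne_zero :
    ∀ v : ℝ → ℝ≥0∞, IsRepulsiveFiniteRange v → v ≠ 0 → ∃ ρ₁ : ℝ, 0 < ρ₁ ∧ ∀ ρ : ℝ, 0 < ρ → ρ < ρ₁ →
    ∀ ε : ℝ, 0 < ε → ∀ η : ℝ, 0 < η → ∃ M : ℝ, ∀ᶠ n : ℕ in atTop,
      groundStateEnergy v (n + 1) (sideLength ρ (n + 1)) ≠ ⊤ →
      ∃ δ : ℝ≥0∞, 0 < δ ∧ ∀ Φ : PeriodicTrialState (n + 1) (sideLength ρ (n + 1)),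
        periodicEnergy v Φ ≤ periodicGroundStateEnergy v (n + 1) (sideLength ρ (n + 1)) + δ →
        ∃ π : Measure (Config (n + 1) × Config (n + 1)),
          π.map Prod.fst = volume.withDensity (fun Z => ENNReal.ofReal (groundState v (n + 1) (sideLength ρ (n + 1)) Z) ^ 2) ∧
          π.map Prod.snd = ((volume.restrict (cellN (n + 1) (sideLength ρ (n + 1)))).withDensity fun W => (‖Φ.ψ W‖₊ : ℝ≥0∞) ^ 2) ∧
          ∃ G : Set (Config (n + 1) × Config (n + 1)), MeasurableSet G ∧
            ENNReal.ofReal (1 - η) ≤ π G ∧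
            ∀ p ∈ G,
              0 < ∫⁻ x in {x : Space | ∀ t, x t ∈ Set.Ioo (1 / 4 * sideLength ρ (n + 1)) (sideLength ρ (n + 1) - 1 / 4 * sideLength ρ (n + 1))},
                  ENNReal.ofReal (groundState v (n + 1) (sideLength ρ (n + 1)) (Matrix.vecCons x (Matrix.vecTail p.1))) ^ 2 ∧
              ∫⁻ x in {x : Space | ∀ t, x t ∈ Set.Ioo (1 / 4 * sideLength ρ (n + 1)) (sideLength ρ (n + 1) - 1 / 4 * sideLength ρ (n + 1))},
                  ENNReal.ofReal (groundState v (n + 1) (sideLength ρ (n + 1)) (Matrix.vecCons x (Matrix.vecTail p.1))) ^ 2 < ⊤ ∧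
              ∫⁻ x, ENNReal.ofReal (groundState v (n + 1) (sideLength ρ (n + 1)) (Matrix.vecCons x (Matrix.vecTail p.1))) ^ 2 < ⊤ ∧
              ∃ S ⊆ {x : Space | ∀ t, x t ∈ Set.Ioo (1 / 4 * sideLength ρ (n + 1)) (sideLength ρ (n + 1) - 1 / 4 * sideLength ρ (n + 1))},
                MeasurableSet S ∧
                volume S ≤ ENNReal.ofReal ε * volume {x : Space | ∀ t, x t ∈ Set.Ioo (1 / 4 * sideLength ρ (n + 1)) (sideLength ρ (n + 1) - 1 / 4 * sideLength ρ (n + 1))} ∧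
                ∫⁻ x in S, ENNReal.ofReal (groundState v (n + 1) (sideLength ρ (n + 1)) (Matrix.vecCons x (Matrix.vecTail p.1))) ^ 2 ≤
                  ENNReal.ofReal ε * ∫⁻ x in {x : Space | ∀ t, x t ∈ Set.Ioo (1 / 4 * sideLength ρ (n + 1)) (sideLength ρ (n + 1) - 1 / 4 * sideLength ρ (n + 1))},
                    ENNReal.ofReal (groundState v (n + 1) (sideLength ρ (n + 1)) (Matrix.vecCons x (Matrix.vecTail p.1))) ^ 2 ∧
                ∫⁻ y in S, ENNReal.ofReal ‖Φ.ψ (Matrix.vecCons y (Matrix.vecTail p.2))‖ ^ 2 ≤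
                  ENNReal.ofReal ε * ∫⁻ y in {x : Space | ∀ t, x t ∈ Set.Ioo (1 / 4 * sideLength ρ (n + 1)) (sideLength ρ (n + 1) - 1 / 4 * sideLength ρ (n + 1))},
                    ENNReal.ofReal ‖Φ.ψ (Matrix.vecCons y (Matrix.vecTail p.2))‖ ^ 2 ∧
                (∀ x ∈ {x : Space | ∀ t, x t ∈ Set.Ioo (1 / 4 * sideLength ρ (n + 1)) (sideLength ρ (n + 1) - 1 / 4 * sideLength ρ (n + 1))} \ S,
                  ∀ y ∈ {x : Space | ∀ t, x t ∈ Set.Ioo (1 / 4 * sideLength ρ (n + 1)) (sideLength ρ (n + 1) - 1 / 4 * sideLength ρ (n + 1))} \ S,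
                    groundState v (n + 1) (sideLength ρ (n + 1)) (Matrix.vecCons x (Matrix.vecTail p.1)) * ‖Φ.ψ (Matrix.vecCons y (Matrix.vecTail p.2))‖ ≤
                      Real.exp M * (groundState v (n + 1) (sideLength ρ (n + 1)) (Matrix.vecCons y (Matrix.vecTail p.1)) * ‖Φ.ψ (Matrix.vecCons x (Matrix.vecTail p.2))‖)) ∧
                ∃ T : Set Space, MeasurableSet T ∧
                  ∫⁻ y in T, ENNReal.ofReal (groundState v (n + 1) (sideLength ρ (n + 1)) (Matrix.vecCons y (Matrix.vecTail p.1))) ^ 2 ≤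
                    ENNReal.ofReal ε * ∫⁻ x, ENNReal.ofReal (groundState v (n + 1) (sideLength ρ (n + 1)) (Matrix.vecCons x (Matrix.vecTail p.1))) ^ 2 ∧
                  ∀ x ∈ {x : Space | ∀ t, x t ∈ Set.Ioo (1 / 4 * sideLength ρ (n + 1)) (sideLength ρ (n + 1) - 1 / 4 * sideLength ρ (n + 1))} \ S,
                    ∀ y ∈ (cell (sideLength ρ (n + 1)) \ {x : Space | ∀ t, x t ∈ Set.Ioo (1 / 4 * sideLength ρ (n + 1)) (sideLength ρ (n + 1) - 1 / 4 * sideLength ρ (n + 1))}) \ T,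
                      groundState v (n + 1) (sideLength ρ (n + 1)) (Matrix.vecCons y (Matrix.vecTail p.1)) * ‖Φ.ψ (Matrix.vecCons x (Matrix.vecTail p.2))‖ ≤
                        Real.exp M * (groundState v (n + 1) (sideLength ρ (n + 1)) (Matrix.vecCons x (Matrix.vecTail p.1)) * ‖Φ.ψ (Matrix.vecCons y (Matrix.vecTail p.2))‖) := by
  sorry

/-- **R′ from the registered stubs** (case split on `v = 0`; proved). -/
theorem stub_coupledRelocationBound :
    ∀ v : ℝ → ℝ≥0∞, IsRepulsiveFiniteRange v → ∃ ρ₁ : ℝ, 0 < ρ₁ ∧ ∀ ρ : ℝ, 0 < ρ → ρ < ρ₁ →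
    ∀ ε : ℝ, 0 < ε → ∀ η : ℝ, 0 < η → ∃ M : ℝ, ∀ᶠ n : ℕ in atTop,
      groundStateEnergy v (n + 1) (sideLength ρ (n + 1)) ≠ ⊤ →
      ∃ δ : ℝ≥0∞, 0 < δ ∧ ∀ Φ : PeriodicTrialState (n + 1) (sideLength ρ (n + 1)),
        periodicEnergy v Φ ≤ periodicGroundStateEnergy v (n + 1) (sideLength ρ (n + 1)) + δ →
        ∃ π : Measure (Config (n + 1) × Config (n + 1)),
          π.map Prod.fst = volume.withDensity (fun Z => ENNReal.ofReal (groundState v (n + 1) (sideLength ρ (n + 1)) Z) ^ 2) ∧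
          π.map Prod.snd = ((volume.restrict (cellN (n + 1) (sideLength ρ (n + 1)))).withDensity fun W => (‖Φ.ψ W‖₊ : ℝ≥0∞) ^ 2) ∧
          ∃ G : Set (Config (n + 1) × Config (n + 1)), MeasurableSet G ∧
            ENNReal.ofReal (1 - η) ≤ π G ∧
            ∀ p ∈ G,
              0 < ∫⁻ x in {x : Space | ∀ t, x t ∈ Set.Ioo (1 / 4 * sideLength ρ (n + 1)) (sideLength ρ (n + 1) - 1 / 4 * sideLength ρ (n + 1))},
                  ENNReal.ofReal (groundState v (n + 1) (sideLength ρ (n + 1)) (Matrix.vecCons x (Matrix.vecTail p.1))) ^ 2 ∧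
              ∫⁻ x in {x : Space | ∀ t, x t ∈ Set.Ioo (1 / 4 * sideLength ρ (n + 1)) (sideLength ρ (n + 1) - 1 / 4 * sideLength ρ (n + 1))},
                  ENNReal.ofReal (groundState v (n + 1) (sideLength ρ (n + 1)) (Matrix.vecCons x (Matrix.vecTail p.1))) ^ 2 < ⊤ ∧
              ∫⁻ x, ENNReal.ofReal (groundState v (n + 1) (sideLength ρ (n + 1)) (Matrix.vecCons x (Matrix.vecTail p.1))) ^ 2 < ⊤ ∧
              ∃ S ⊆ {x : Space | ∀ t, x t ∈ Set.Ioo (1 / 4 * sideLength ρ (n + 1)) (sideLength ρ (n + 1) - 1 / 4 * sideLength ρ (n + 1))},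
                MeasurableSet S ∧
                volume S ≤ ENNReal.ofReal ε * volume {x : Space | ∀ t, x t ∈ Set.Ioo (1 / 4 * sideLength ρ (n + 1)) (sideLength ρ (n + 1) - 1 / 4 * sideLength ρ (n + 1))} ∧
                ∫⁻ x in S, ENNReal.ofReal (groundState v (n + 1) (sideLength ρ (n + 1)) (Matrix.vecCons x (Matrix.vecTail p.1))) ^ 2 ≤
                  ENNReal.ofReal ε * ∫⁻ x in {x : Space | ∀ t, x t ∈ Set.Ioo (1 / 4 * sideLength ρ (n + 1)) (sideLength ρ (n + 1) - 1 / 4 * sideLength ρ (n + 1))},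
                    ENNReal.ofReal (groundState v (n + 1) (sideLength ρ (n + 1)) (Matrix.vecCons x (Matrix.vecTail p.1))) ^ 2 ∧
                ∫⁻ y in S, ENNReal.ofReal ‖Φ.ψ (Matrix.vecCons y (Matrix.vecTail p.2))‖ ^ 2 ≤
                  ENNReal.ofReal ε * ∫⁻ y in {x : Space | ∀ t, x t ∈ Set.Ioo (1 / 4 * sideLength ρ (n + 1)) (sideLength ρ (n + 1) - 1 / 4 * sideLength ρ (n + 1))},
                    ENNReal.ofReal ‖Φ.ψ (Matrix.vecCons y (Matrix.vecTail p.2))‖ ^ 2 ∧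
                (∀ x ∈ {x : Space | ∀ t, x t ∈ Set.Ioo (1 / 4 * sideLength ρ (n + 1)) (sideLength ρ (n + 1) - 1 / 4 * sideLength ρ (n + 1))} \ S,
                  ∀ y ∈ {x : Space | ∀ t, x t ∈ Set.Ioo (1 / 4 * sideLength ρ (n + 1)) (sideLength ρ (n + 1) - 1 / 4 * sideLength ρ (n + 1))} \ S,
                    groundState v (n + 1) (sideLength ρ (n + 1)) (Matrix.vecCons x (Matrix.vecTail p.1)) * ‖Φ.ψ (Matrix.vecCons y (Matrix.vecTail p.2))‖ ≤
                      Real.exp M * (groundState v (n + 1) (sideLength ρ (n + 1)) (Matrix.vecCons y (Matrix.vecTail p.1)) * ‖Φ.ψ (Matrix.vecCons x (Matrix.vecTail p.2))‖)) ∧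
                ∃ T : Set Space, MeasurableSet T ∧
                  ∫⁻ y in T, ENNReal.ofReal (groundState v (n + 1) (sideLength ρ (n + 1)) (Matrix.vecCons y (Matrix.vecTail p.1))) ^ 2 ≤
                    ENNReal.ofReal ε * ∫⁻ x, ENNReal.ofReal (groundState v (n + 1) (sideLength ρ (n + 1)) (Matrix.vecCons x (Matrix.vecTail p.1))) ^ 2 ∧
                  ∀ x ∈ {x : Space | ∀ t, x t ∈ Set.Ioo (1 / 4 * sideLength ρ (n + 1)) (sideLength ρ (n + 1) - 1 / 4 * sideLength ρ (n + 1))} \ S,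
                    ∀ y ∈ (cell (sideLength ρ (n + 1)) \ {x : Space | ∀ t, x t ∈ Set.Ioo (1 / 4 * sideLength ρ (n + 1)) (sideLength ρ (n + 1) - 1 / 4 * sideLength ρ (n + 1))}) \ T,
                      groundState v (n + 1) (sideLength ρ (n + 1)) (Matrix.vecCons y (Matrix.vecTail p.1)) * ‖Φ.ψ (Matrix.vecCons x (Matrix.vecTail p.2))‖ ≤
                        Real.exp M * (groundState v (n + 1) (sideLength ρ (n + 1)) (Matrix.vecCons x (Matrix.vecTail p.1)) * ‖Φ.ψ (Matrix.vecCons y (Matrix.vecTail p.2))‖) := by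
  intro v hv
  by_cases h0 : v = 0
  · subst h0
    exact stub_freeCoupledRelocation (stub_freeGroundState stub_freeDirichletGap stub_freeOneBodyApprox)
      stub_freeTorusSlices
  · exact stub_coupledRelocationBound_ne_zero v hv h0

/-- **Stub M** (LANDED p139456, `CoupledBaths.stub_multiplicativeTransfer`). -/
theorem stub_multiplicativeTransfer :
    ∀ (C : Set Space) (f g : Space → ℝ) (M : ℝ), MeasurableSet C → Measurable f → Measurable g →
    (∀ x ∈ C, 0 ≤ f x) → (∀ x ∈ C, 0 ≤ g x) →
    (∀ x ∈ C, ∀ y ∈ C, f x * g y ≤ Real.exp M * (f y * g x)) →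
      (∫⁻ x in C, ENNReal.ofReal (g x)) ^ 2 * ∫⁻ x in C, ENNReal.ofReal (f x) ^ 2 ≤
        ENNReal.ofReal (Real.exp (2 * M)) *
          ((∫⁻ x in C, ENNReal.ofReal (f x)) ^ 2 * ∫⁻ x in C, ENNReal.ofReal (g x) ^ 2) :=
  _root_.Summit.AtomisticToContinuum.BoseEinsteinCondensation.CoupledBaths.stub_multiplicativeTransfer

/-- **Stub B′** (LANDED p143900, `CoupledBaths.stub_boxTransferBath`): the box transfer, bath level. -/
theorem stub_boxTransferBath :
    (∀ (C : Set Space) (f g : Space → ℝ) (M : ℝ), MeasurableSet C → Measurable f → Measurable g →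
      (∀ x ∈ C, 0 ≤ f x) → (∀ x ∈ C, 0 ≤ g x) →
      (∀ x ∈ C, ∀ y ∈ C, f x * g y ≤ Real.exp M * (f y * g x)) →
        (∫⁻ x in C, ENNReal.ofReal (g x)) ^ 2 * ∫⁻ x in C, ENNReal.ofReal (f x) ^ 2 ≤
          ENNReal.ofReal (Real.exp (2 * M)) *
            ((∫⁻ x in C, ENNReal.ofReal (f x)) ^ 2 * ∫⁻ x in C, ENNReal.ofReal (g x) ^ 2)) →
    ∀ (v : ℝ → ℝ≥0∞) (n : ℕ) (L : ℝ), 0 < L → groundStateEnergy v (n + 1) L ≠ ⊤ →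
    ∀ (c ε η M : ℝ), 0 < c → 0 < ε → ε ≤ Real.sqrt c / 8 → ε ≤ 1 / 2 → 0 < η → η < c / 16 →
    ∀ Φ : PeriodicTrialState (n + 1) L,
      (∃ π : Measure (Config (n + 1) × Config (n + 1)),
        π.map Prod.fst = volume.withDensity (fun Z => ENNReal.ofReal (groundState v (n + 1) L Z) ^ 2) ∧
        π.map Prod.snd = ((volume.restrict (cellN (n + 1) L)).withDensity fun W => (‖Φ.ψ W‖₊ : ℝ≥0∞) ^ 2) ∧
        ∃ G : Set (Config (n + 1) × Config (n + 1)), MeasurableSet G ∧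
          ENNReal.ofReal (1 - η) ≤ π G ∧
          ∀ p ∈ G,
              0 < ∫⁻ x in {x : Space | ∀ t, x t ∈ Set.Ioo (1 / 4 * L) (L - 1 / 4 * L)},
                  ENNReal.ofReal (groundState v (n + 1) L (Matrix.vecCons x (Matrix.vecTail p.1))) ^ 2 ∧
              ∫⁻ x in {x : Space | ∀ t, x t ∈ Set.Ioo (1 / 4 * L) (L - 1 / 4 * L)},
                  ENNReal.ofReal (groundState v (n + 1) L (Matrix.vecCons x (Matrix.vecTail p.1))) ^ 2 < ⊤ ∧
              ∫⁻ x, ENNReal.ofReal (groundState v (n + 1) L (Matrix.vecCons x (Matrix.vecTail p.1))) ^ 2 < ⊤ ∧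
              ∃ S ⊆ {x : Space | ∀ t, x t ∈ Set.Ioo (1 / 4 * L) (L - 1 / 4 * L)},
                MeasurableSet S ∧
                volume S ≤ ENNReal.ofReal ε * volume {x : Space | ∀ t, x t ∈ Set.Ioo (1 / 4 * L) (L - 1 / 4 * L)} ∧
                ∫⁻ x in S, ENNReal.ofReal (groundState v (n + 1) L (Matrix.vecCons x (Matrix.vecTail p.1))) ^ 2 ≤
                  ENNReal.ofReal ε * ∫⁻ x in {x : Space | ∀ t, x t ∈ Set.Ioo (1 / 4 * L) (L - 1 / 4 * L)},
                    ENNReal.ofReal (groundState v (n + 1) L (Matrix.vecCons x (Matrix.vecTail p.1))) ^ 2 ∧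
                ∫⁻ y in S, ENNReal.ofReal ‖Φ.ψ (Matrix.vecCons y (Matrix.vecTail p.2))‖ ^ 2 ≤
                  ENNReal.ofReal ε * ∫⁻ y in {x : Space | ∀ t, x t ∈ Set.Ioo (1 / 4 * L) (L - 1 / 4 * L)},
                    ENNReal.ofReal ‖Φ.ψ (Matrix.vecCons y (Matrix.vecTail p.2))‖ ^ 2 ∧
                (∀ x ∈ {x : Space | ∀ t, x t ∈ Set.Ioo (1 / 4 * L) (L - 1 / 4 * L)} \ S,
                  ∀ y ∈ {x : Space | ∀ t, x t ∈ Set.Ioo (1 / 4 * L) (L - 1 / 4 * L)} \ S,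
                    groundState v (n + 1) L (Matrix.vecCons x (Matrix.vecTail p.1)) * ‖Φ.ψ (Matrix.vecCons y (Matrix.vecTail p.2))‖ ≤
                      Real.exp M * (groundState v (n + 1) L (Matrix.vecCons y (Matrix.vecTail p.1)) * ‖Φ.ψ (Matrix.vecCons x (Matrix.vecTail p.2))‖)) ∧
                ∃ T : Set Space, MeasurableSet T ∧
                  ∫⁻ y in T, ENNReal.ofReal (groundState v (n + 1) L (Matrix.vecCons y (Matrix.vecTail p.1))) ^ 2 ≤
                    ENNReal.ofReal ε * ∫⁻ x, ENNReal.ofReal (groundState v (n + 1) L (Matrix.vecCons x (Matrix.vecTail p.1))) ^ 2 ∧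
                  ∀ x ∈ {x : Space | ∀ t, x t ∈ Set.Ioo (1 / 4 * L) (L - 1 / 4 * L)} \ S,
                    ∀ y ∈ (cell L \ {x : Space | ∀ t, x t ∈ Set.Ioo (1 / 4 * L) (L - 1 / 4 * L)}) \ T,
                      groundState v (n + 1) L (Matrix.vecCons y (Matrix.vecTail p.1)) * ‖Φ.ψ (Matrix.vecCons x (Matrix.vecTail p.2))‖ ≤
                        Real.exp M * (groundState v (n + 1) L (Matrix.vecCons x (Matrix.vecTail p.1)) * ‖Φ.ψ (Matrix.vecCons y (Matrix.vecTail p.2))‖)) →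
      (∃ E : Set (Config (n + 1)), MeasurableSet E ∧
        ENNReal.ofReal (c / 16) ≤ ((volume.restrict (cellN (n + 1) L)).withDensity fun W => (‖Φ.ψ W‖₊ : ℝ≥0∞) ^ 2) E ∧
        ∀ W ∈ E,
            0 < ∫⁻ y in {x : Space | ∀ t, x t ∈ Set.Ioo (1 / 4 * L) (L - 1 / 4 * L)},
                ENNReal.ofReal ‖Φ.ψ (Matrix.vecCons y (Matrix.vecTail W))‖ ^ 2 ∧
            ∫⁻ y in cell L, ENNReal.ofReal ‖Φ.ψ (Matrix.vecCons y (Matrix.vecTail W))‖ ^ 2 < ⊤ ∧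
            ENNReal.ofReal (c / 16) * ∫⁻ y in cell L, ENNReal.ofReal ‖Φ.ψ (Matrix.vecCons y (Matrix.vecTail W))‖ ^ 2 ≤
              ∫⁻ y in {x : Space | ∀ t, x t ∈ Set.Ioo (1 / 4 * L) (L - 1 / 4 * L)},
                ENNReal.ofReal ‖Φ.ψ (Matrix.vecCons y (Matrix.vecTail W))‖ ^ 2 ∧
            ENNReal.ofReal (c / 16) *
                (volume {x : Space | ∀ t, x t ∈ Set.Ioo (1 / 4 * L) (L - 1 / 4 * L)} *
                  ∫⁻ y in {x : Space | ∀ t, x t ∈ Set.Ioo (1 / 4 * L) (L - 1 / 4 * L)},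
                    ENNReal.ofReal ‖Φ.ψ (Matrix.vecCons y (Matrix.vecTail W))‖ ^ 2) ≤
              (∫⁻ y in {x : Space | ∀ t, x t ∈ Set.Ioo (1 / 4 * L) (L - 1 / 4 * L)},
                  ENNReal.ofReal ‖Φ.ψ (Matrix.vecCons y (Matrix.vecTail W))‖) ^ 2) →
      ENNReal.ofReal ((c / 16 - η) * ((Real.exp (-2 * M) * ((1 - ε) * (Real.sqrt c / 4 - ε) ^ 2)) *
          ((1 - ε) / (1 + 16 * Real.exp (2 * M) / (c * (1 - ε))))) / 2 *
          (n + 1 : ℕ)) ≤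
        occupation (n + 1)
          (Set.indicator {x : Space | ∀ t, x t ∈ Set.Ioo (1 / 4 * L) (L - 1 / 4 * L)}
            (fun _ => ((Real.sqrt (((1 - 2 * (1 / 4)) * L) ^ 3))⁻¹ : ℂ)))
          fun Z => (groundState v (n + 1) L Z : ℂ) :=
  _root_.Summit.AtomisticToContinuum.BoseEinsteinCondensation.CoupledBaths.stub_boxTransferBath

/-- **Stub C** (LANDED p140758, `CoupledBaths.stub_closing`). -/
theorem stub_closing :
    ∀ v : ℝ → ℝ≥0∞, IsRepulsiveFiniteRange v → BECWallDressingTransfer.GroundStateRigidity →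
    ∃ ρ₂ : ℝ, 0 < ρ₂ ∧ ∀ ρ : ℝ, 0 < ρ → ρ < ρ₂ → ∀ κ : ℝ, 0 < κ →
      (∀ᶠ n : ℕ in atTop,
        groundStateEnergy v (n + 1) (sideLength ρ (n + 1)) ≠ ⊤ ∧
        ENNReal.ofReal (κ * (n + 1 : ℕ)) ≤
          occupation (n + 1)
            (Set.indicator {x : Space | ∀ t, x t ∈ Set.Ioo (1 / 4 * sideLength ρ (n + 1)) (sideLength ρ (n + 1) - 1 / 4 * sideLength ρ (n + 1))}
              (fun _ => ((Real.sqrt (((1 - 2 * (1 / 4)) * sideLength ρ (n + 1)) ^ 3))⁻¹ : ℂ)))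
            fun Z => (groundState v (n + 1) (sideLength ρ (n + 1)) Z : ℂ)) →
      HasGroundStateBEC v ρ :=
  _root_.Summit.AtomisticToContinuum.BoseEinsteinCondensation.CoupledBaths.stub_closing

/-- **Stub Rig** (POOLED item stmt-AtomisticToContinuum-9072, verbatim the imported route decl):
`L²`-rigidity of Dirichlet near-minimisers up to phase. -/
theorem stub_rigidity : BECWallDressingTransfer.GroundStateRigidity := by
  sorry

/-! ### The unfolded stub signatures are definitionally the named statements -/

example : TorusTypicality := stub_torusTypicalityBath
example : CoupledRelocationBound := stub_coupledRelocationBound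
example : MultiplicativeFlatnessTransfer := stub_multiplicativeTransfer
example : BoxTransfer := stub_boxTransferBath
example : ClosingChain := stub_closing

/-! ### Assembly (proved) -/

/-- The box constant is positive for the assembly's choice of tolerances
(`ε ≤ √c/8`, `ε ≤ 1/2`, `η < c/16`). -/
theorem boxConstant_pos {c ε η : ℝ} (M : ℝ) (hc : 0 < c) (hε1 : ε ≤ Real.sqrt c / 8)
    (hε2 : ε ≤ 1 / 2) (hη : η < c / 16) : 0 < boxConstant c ε η M := by
  unfold boxConstant
  have h1 : 0 < c / 16 - η := by linarith
  have h2 : 0 < 1 - ε := by linarith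
  have hsc : 0 < Real.sqrt c := Real.sqrt_pos.2 hc
  have h3 : 0 < Real.sqrt c / 4 - ε := by linarith
  positivity

/-- **Assembly** (quantifier bookkeeping; proved).  Given `v` admissible and the `A`-instance
`PeriodicBECAt v` (constant `c` below `ρ_A`), take `ρ₀ := min (min ρ_A ρ₁) (min ρ_e ρ₂)` with `ρ₁`
from R′, `ρ_e` from the eventual finiteness of `E₀^D`
(`BECInsertionVariance.eventually_groundStateEnergy_ne_top`) and `ρ₂` from C; fix
`ε := min (√c/8) (1/2)`, `η := c/32`, get `M` from R′; eventually in `n` (shifting `A` and the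
finiteness to `N = n+1` along `tendsto_add_atTop_nat 1`): T′ at slack `min δ_A δ_R` gives the torus
near-minimiser `Φ` and its typical bath event, R′ the coupling, B′ the inner flat-mode occupation
`≥ κ(c,ε,η,M)(n+1)` of the Dirichlet ground state, and C closes `HasGroundStateBEC v ρ`. -/
theorem assembly (hT : TorusTypicality) (hR : CoupledRelocationBound)
    (hM : MultiplicativeFlatnessTransfer) (hB : BoxTransfer) (hC : ClosingChain)
    (hRig : BECWallDressingTransfer.GroundStateRigidity) :
    BECInsertionCorrector.BoundaryTransferWeak := by
  intro v hv hA
  obtain ⟨ρA, hρA, HA⟩ := hA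
  obtain ⟨ρ₁, hρ₁, HR⟩ := hR v hv
  obtain ⟨ρe, hρe, HE⟩ :=
    Summit.AtomisticToContinuum.BoseEinsteinCondensation.Theorems.BECInsertionVariance.eventually_groundStateEnergy_ne_top
      hv
  obtain ⟨ρ₂, hρ₂, HC⟩ := hC v hv hRig
  refine ⟨min (min ρA ρ₁) (min ρe ρ₂), lt_min (lt_min hρA hρ₁) (lt_min hρe hρ₂),
    fun ρ hρ hρlt => ?_⟩
  have hρA' : ρ < ρA := hρlt.trans_le ((min_le_left _ _).trans (min_le_left _ _))
  have hρ₁' : ρ < ρ₁ := hρlt.trans_le ((min_le_left _ _).trans (min_le_right _ _))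
  have hρe' : ρ < ρe := hρlt.trans_le ((min_le_right _ _).trans (min_le_left _ _))
  have hρ₂' : ρ < ρ₂ := hρlt.trans_le ((min_le_right _ _).trans (min_le_right _ _))
  obtain ⟨c, hc, hAev⟩ := HA ρ hρ hρA'
  -- tolerances, fixed before `N`
  set ε : ℝ := min (Real.sqrt c / 8) (1 / 2) with hεdef
  set η : ℝ := c / 32 with hηdef
  have hsc : 0 < Real.sqrt c := Real.sqrt_pos.2 hc
  have hε : 0 < ε := lt_min (by positivity) (by norm_num)
  have hε1 : ε ≤ Real.sqrt c / 8 := min_le_left _ _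
  have hε2 : ε ≤ 1 / 2 := min_le_right _ _
  have hη : 0 < η := by positivity
  have hη' : η < c / 16 := by rw [hηdef]; linarith
  obtain ⟨M, hRev⟩ := HR ρ hρ hρ₁' ε hε η hη
  have hκ : 0 < boxConstant c ε η M := boxConstant_pos M hc hε1 hε2 hη'
  -- shift `A` and the finiteness of `E₀^D` to `N = n + 1`
  have hAev' := (tendsto_add_atTop_nat 1).eventually hAev
  have hEev' := (tendsto_add_atTop_nat 1).eventually (HE ρ hρ hρe')
  refine HC ρ hρ hρ₂' (boxConstant c ε η M) hκ ?_
  filter_upwards [hAev', hEev', hRev] with n hAn hEn hRn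
  refine ⟨hEn, ?_⟩
  obtain ⟨δA, hδA, hAΦ⟩ := hAn
  obtain ⟨δR, hδR, hRΦ⟩ := hRn hEn
  have hL : 0 < sideLength ρ (n + 1) := by
    unfold sideLength
    exact Real.rpow_pos_of_pos (div_pos (Nat.cast_pos.mpr (Nat.succ_pos n)) hρ) _
  -- T′ at slack `min δA δR`: the torus near-minimiser and its typical bath event
  obtain ⟨Φ, hΦE, E, hEm, hPE, hEgood⟩ := hT v n (sideLength ρ (n + 1)) hL c hc (min δA δR)
    (lt_min hδA hδR) fun Φ hΦ => hAΦ Φ (hΦ.trans (add_le_add_right (min_le_left _ _) _))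
  -- R′: the coupling with its good event
  obtain ⟨π, hπ1, hπ2, G, hG, hπG, hGood⟩ :=
    hRΦ Φ (hΦE.trans (add_le_add_right (min_le_right _ _) _))
  -- B′: the inner flat mode of the box is occupied in the Dirichlet ground state
  exact hB hM v n (sideLength ρ (n + 1)) hL hEn c ε η M hc hε hε1 hε2 hη hη' Φ
    ⟨π, hπ1, hπ2, G, hG, hπG, hGood⟩ ⟨E, hEm, hPE, hEgood⟩

/-! ### Composition -/

/-- **The crux from the registered stubs (by name).** -/
theorem BoundaryTransferWeak_of : BECInsertionCorrector.BoundaryTransferWeak :=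
  assembly stub_torusTypicalityBath stub_coupledRelocationBound stub_multiplicativeTransfer
    stub_boxTransferBath stub_closing stub_rigidity

/-- **The crux as recorded on the item** (`BECPeriodicReduction.BoundaryTransferWeak`, the decl the
ledger item stmt-AtomisticToContinuum-0827 carries; shared verbatim — `rfl` — with
`BECInsertionCorrector.BoundaryTransferWeak` and 75 other route files). -/
theorem BoundaryTransferWeak_proof : BECPeriodicReduction.BoundaryTransferWeak :=
  BoundaryTransferWeak_of

/-- Sanity: the two route copies are syntactically the same `Prop`. -/
example : BECInsertionCorrector.BoundaryTransferWeak = BECPeriodicReduction.BoundaryTransferWeak :=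
  rfl

end Summit.AtomisticToContinuum.BoseEinsteinCondensation.Cruxes.BoundaryTransferWeak.CoupledBaths

end
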